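import Literature.NumberTheory.EllipticCurves.CyclicIsogenyCharacterFrobeniusProofs
import Literature.NumberTheory.EllipticCurves.OpenImageMazurProofs
import Literature.NumberTheory.EllipticCurves.NoConductorOne
import HarnessLib

/-!
# A rational `3`-isogeny forces `3 ∣ a_ℓ(E)` at every good prime `ℓ ≡ 2 (mod 3)`
# (reducible `ρ̄_{E,N}` ⟹ `a_ℓ ≡ u + ℓ u⁻¹ (mod N)`, `u ∈ 𝔽_N^×`; specialised to `N = 3`)

Topic `Literature/NumberTheory/EllipticCurves`; THEOREMS ONLY (no definition, no named fact; net
Literature debt `0`).  Literature-prover `-ty` g22 of cell `bsd-f1-sign2`, serving REF1-AUDIT §301 rider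
R301b («a literature-prover may vendor (T) under `Literature/NumberTheory/EllipticCurves/` and discharge
it»): the cell's print-fact shape (T) `ModThreeReducibleTraceVanishing` of
`Summits/BirchSwinnertonDyer/Rank1Residual/F1Sign2/TwistLatticeAtTwo.lean` (-es g24, ES-33 addendum 4)
is here a THEOREM, so that the kernel glue `threeIsogenyTwist_of_oddStabiliser` ((Gℓ) ∧ (T) ⟹ (G₃)) needs
only (Gℓ).

**Mathematics (as printed).** Mazur 1978, §5 (p. 148): a `ℚ`-rational cyclic subgroup `C_N ⊂ E[N]` of prime
order `N` carries the isogeny character `r : Gal(ℚ̄/ℚ) → Aut(C_N) = 𝔽_N^×`; §6 Prop. 6.3 (1) / Cor. 6.1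
(1) (p. 153), at a prime `ℓ ≠ N` of GOOD reduction: `r(σ_ℓ) + ℓ·r(σ_ℓ)⁻¹ ≡ a_ℓ (mod N)` («Equation (1)
is obtained by computing the trace of Frobenius»; Silverman AEC V.2.3.1 for the trace, III.8.6 / the
Weil pairing for `det ρ̄_{E,N} = χ̄_N`).  For `N = 3` the group `𝔽₃^× = {±1}` has exponent `2`, so
`r(σ_ℓ)² = 1` and the root relation `r² − a_ℓ r + ℓ ≡ 0` reads `a_ℓ·r ≡ 1 + ℓ (mod 3)`: for
`ℓ ≡ 2 (mod 3)` this is `3 ∣ a_ℓ`, for `ℓ ≡ 1 (mod 3)` it is `a_ℓ ≡ ±2`, so `3 ∤ a_ℓ` (Serre 1972 §5.4-type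
congruences for the reducible case).

**What is used from the tree (all PROVED there).** The dictionary «reducible `ρ̄_{E,N}` ⟺ a
`Γ_ℚ`-stable subgroup of order `N`» and the isogeny character of a stable line
(`Mazur1978.not_hasIrreducibleModPGaloisRep_iff_exists_natCard_eq`, `Mazur1978.exists_eq_zmultiples_of_natCard_eq`,
`Mazur1978.exists_isogenyCharacter`, file `OpenImageMazurProofs`); Prop. 6.3 (1) at a good prime
(`Mazur1978.isogenyCharacter_sq_sub_frobeniusTrace_mul_add_eq_zero`, file `OpenImageMazurFrobeniusProofs`);
existence of a prime of `\bar ℤ` above `ℓ` and of an arithmetic Frobenius there (`primesAbove_nonempty`,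
`exists_isArithFrobAt_of_mem_primesAbove_holds`); «`ℓ ∤ N_E` ⟹ good reduction at `ℓ`»
(`WeierstrassCurve.hasGoodReductionAtPrime_of_not_dvd_conductorNorm'`, file `NoConductorOne`).

**Contents.**
* `exists_isogenyCharacter_of_not_hasIrreducibleModPGaloisRep` — reducible `E[N]` (`N` prime) over a field
  `F` with `N ≠ 0` in `F`: a point `P ∈ E[N] ∖ {O}` and a character `r : Γ_F → 𝔽_N^×` with `σ P = r(σ) P`.
* `exists_unit_root_frobeniusCharpoly_of_not_hasIrreducibleModPGaloisRep` — over `ℚ`, global minimal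
  model, `ℓ ≠ N` good: some `u ∈ 𝔽_N^×` has `u² − a_ℓ u + ℓ = 0` in `𝔽_N`.
* `three_dvd_frobeniusTrace_of_not_hasIrreducibleModPGaloisRep_three` (`ℓ ≡ 2 (mod 3)` good ⟹ `3 ∣ a_ℓ`),
  `not_three_dvd_frobeniusTrace_of_not_hasIrreducibleModPGaloisRep_three` (`ℓ ≡ 1 (mod 3)` good ⟹ `3 ∤ a_ℓ`),
  and the conductor-indexed form `three_dvd_frobeniusTrace_of_not_hasIrreducibleModPGaloisRep_three_of_not_dvd_conductorNorm`
  (hypothesis `ℓ ∤ N_E` instead of good reduction) — VERBATIM the body of the cell's (T).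

## References

* [Mazur1978] B. Mazur, *Rational isogenies of prime degree*, Invent. Math. 44 (1978) 129–162: §5 (p. 148,
  the isogeny character), §6 Prop. 6.3 (1), Cor. 6.1 (1) (p. 153).
* [Silverman2009] J. H. Silverman, *The Arithmetic of Elliptic Curves*, 2nd ed., GTM 106: III.8.6, V.2.3.1.
* [Serre1972] J.-P. Serre, *Propriétés galoisiennes des points d'ordre fini des courbes elliptiques*,
  Invent. Math. 15 (1972), §5.
-/

noncomputable section

open scoped Classical
open NumberField IsDedekindDomain IsDedekindDomain.HeightOneSpectrum Field WeierstrassCurve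

namespace Literature.NumberTheory.EllipticCurves

/-- **Reducible `ρ̄_{E,N}` gives an isogeny character.** For an elliptic curve `E` over a field `F`, a prime
`N` invertible in `F` and `E[N]` NOT an irreducible `Γ_F`-module, there are a point `P ∈ E[N] ∖ {O}` and a
homomorphism `r : Γ_F → 𝔽_N^×` with `σ P = r(σ) P` for all `σ ∈ Γ_F` (the isogeny character of the stable
line `⟨P⟩ = C_N`, Mazur 1978 §5: «the character `r : Gal(K̄/K)^{ab} → Aut(C_N) = (ℤ/Nℤ)^*` defined by the
natural action of Galois on the cyclic subgroup `C_N`»).  Assembly of the tree's dictionary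
(`Mazur1978.not_hasIrreducibleModPGaloisRep_iff_exists_natCard_eq`, `…exists_eq_zmultiples_of_natCard_eq`,
`…exists_isogenyCharacter`).
[cite: Mazur1978, §5 (p. 148, the isogeny character) and Thm. 1 (rational N-isogenies)] -/
theorem exists_isogenyCharacter_of_not_hasIrreducibleModPGaloisRep {F : Type*} [Field F]
    (W : WeierstrassCurve F) [W.IsElliptic] (N : ℕ) [Fact N.Prime] [NeZero (N : F)]
    (hred : ¬ W.HasIrreducibleModPGaloisRep N) :
    ∃ (P : geomTorsion W N) (r : absoluteGaloisGroup F →* (ZMod N)ˣ), P ≠ 0 ∧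
      ∀ σ : absoluteGaloisGroup F, σ • P = ((r σ : (ZMod N)ˣ) : ZMod N).val • P := by
  obtain ⟨H, hst, hcard⟩ :=
    (Mazur1978.not_hasIrreducibleModPGaloisRep_iff_exists_natCard_eq W N).mp hred
  obtain ⟨P, hP0, rfl⟩ := Mazur1978.exists_eq_zmultiples_of_natCard_eq W N hcard
  have hstP : ∀ σ : absoluteGaloisGroup F, σ • P ∈ AddSubgroup.zmultiples P :=
    fun σ ↦ hst σ P (AddSubgroup.mem_zmultiples P)
  obtain ⟨r, hr⟩ := Mazur1978.exists_isogenyCharacter W N hP0 hstP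
  exact ⟨P, r, hP0, hr⟩

/-- **Reducible `ρ̄_{E,N}` ⟹ the characteristic polynomial of Frobenius has a unit root mod `N`.** For `E/ℚ`
in global minimal form, `N` a prime with `E[N]` reducible, and a prime `ℓ ≠ N` of good reduction, there is
`u ∈ 𝔽_N^×` with `u² − a_ℓ·u + ℓ = 0` in `𝔽_N` (namely `u = r(σ_ℓ)` for the isogeny character `r` and an
arithmetic Frobenius `σ_ℓ` above `ℓ`: Mazur 1978 Prop. 6.3 (1), «Equation (1) is obtained by computing the trace
of Frobenius»; tree: `Mazur1978.isogenyCharacter_sq_sub_frobeniusTrace_mul_add_eq_zero`).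
[cite: Mazur1978, §6 Prop. 6.3 (1) and Cor. 6.1 (1) (p. 153)] -/
theorem exists_unit_root_frobeniusCharpoly_of_not_hasIrreducibleModPGaloisRep (W : WeierstrassCurve ℚ)
    [W.IsElliptic] [W.IsGloballyMinimal] (N ℓ : ℕ) [Fact N.Prime] [Fact ℓ.Prime] (hℓN : ℓ ≠ N)
    (hgood : W.HasGoodReductionAtPrime ℓ) (hred : ¬ W.HasIrreducibleModPGaloisRep N) :
    ∃ u : (ZMod N)ˣ, (u : ZMod N) ^ 2 - (W.frobeniusTrace ℓ : ZMod N) * (u : ZMod N) + (ℓ : ZMod N) = 0 := by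
  have hℓ : ℓ.Prime := Fact.out
  haveI : NeZero N := ⟨(Fact.out : N.Prime).ne_zero⟩
  haveI : NeZero (N : ℚ) := NeZero.charZero
  obtain ⟨P, r, hP0, hr⟩ := exists_isogenyCharacter_of_not_hasIrreducibleModPGaloisRep W N hred
  -- the place `v` of `ℚ` at `ℓ`, a prime `𝔓` of `\bar ℤ` above it and an arithmetic Frobenius `φ`
  set v : HeightOneSpectrum (𝓞 ℚ) :=
    (Rat.HeightOneSpectrum.primesEquiv (R := 𝓞 ℚ)).symm ⟨ℓ, hℓ⟩ with hvdef
  have hvℓ : (Rat.HeightOneSpectrum.primesEquiv v : ℕ) = ℓ := by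
    rw [hvdef, Equiv.apply_symm_apply]
  have hv : (ℓ : 𝓞 ℚ) ∈ v.asIdeal := by
    rw [DeuringLadic.natCast_mem_asIdeal_iff v ℓ, hvℓ]
  obtain ⟨𝔓, h𝔓⟩ := v.primesAbove_nonempty
  obtain ⟨φ, hφ⟩ := exists_isArithFrobAt_of_mem_primesAbove_holds (v := v) h𝔓
  exact ⟨r φ, Mazur1978.isogenyCharacter_sq_sub_frobeniusTrace_mul_add_eq_zero W N ℓ hℓN hgood hP0 hr
    hv h𝔓 hφ⟩

/-- `1 + 2 = 0` in `𝔽₃` (private arithmetic helper). [folklore] -/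
private theorem zmod_three_one_add_two : (1 : ZMod 3) + 2 = 0 := by decide

/-- `1 + 1 ≠ 0` in `𝔽₃` (private arithmetic helper). [folklore] -/
private theorem zmod_three_one_add_one_ne_zero : (1 : ZMod 3) + 1 ≠ 0 := by decide

/-- The units of `𝔽₃` square to `1` (`𝔽₃^× = {±1}`; private arithmetic helper). [folklore] -/
private theorem units_zmod_three_sq_eq_one (u : (ZMod 3)ˣ) : (u : ZMod 3) ^ 2 = 1 := by
  have hu : IsUnit (u : ZMod 3) := u.isUnit
  revert hu
  generalize (u : ZMod 3) = x
  decide +revert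

/-- **A rational `3`-isogeny forces `3 ∣ a_ℓ` at every good prime `ℓ ≡ 2 (mod 3)`.** For `E/ℚ` in global
minimal form with `E[3]` a reducible `Γ_ℚ`-module and a prime `ℓ ≡ 2 (mod 3)` of good reduction,
`3 ∣ a_ℓ(E) = ℓ + 1 − #Ẽ(𝔽_ℓ)`: by Mazur's Prop. 6.3 (1), `a_ℓ ≡ r + ℓ r⁻¹ = r(1 + ℓ) ≡ 0 (mod 3)` since
`r = ±1 = r⁻¹` in `𝔽₃^×`.
[cite: Mazur1978, §6 Prop. 6.3 (1) (p. 153)]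
[cite: Silverman2009, V.2.3.1 and III.8.6] -/
theorem three_dvd_frobeniusTrace_of_not_hasIrreducibleModPGaloisRep_three (W : WeierstrassCurve ℚ)
    [W.IsElliptic] [W.IsGloballyMinimal] (hred : ¬ W.HasIrreducibleModPGaloisRep 3) {ℓ : ℕ}
    [Fact ℓ.Prime] (hgood : W.HasGoodReductionAtPrime ℓ) (hℓ3 : ℓ % 3 = 2) :
    (3 : ℤ) ∣ W.frobeniusTrace ℓ := by
  haveI : Fact (Nat.Prime 3) := ⟨Nat.prime_three⟩
  have hℓ3' : ℓ ≠ 3 := by rintro rfl; simp at hℓ3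
  obtain ⟨u, hu⟩ :=
    exists_unit_root_frobeniusCharpoly_of_not_hasIrreducibleModPGaloisRep W 3 ℓ hℓ3' hgood hred
  have hsq : (u : ZMod 3) ^ 2 = 1 := units_zmod_three_sq_eq_one u
  have hℓc : (ℓ : ZMod 3) = 2 := by
    have h := (ZMod.natCast_mod ℓ 3).symm
    rw [hℓ3] at h
    simpa using h
  rw [hsq, hℓc] at hu
  -- `hu : 1 - a * u + 2 = 0`, i.e. `a * u = 0`; `u` is a unit
  have hau : (W.frobeniusTrace ℓ : ZMod 3) * (u : ZMod 3) = 0 := by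
    linear_combination zmod_three_one_add_two - hu
  have ha : (W.frobeniusTrace ℓ : ZMod 3) = 0 := (Units.mul_left_eq_zero u).mp hau
  exact (ZMod.intCast_zmod_eq_zero_iff_dvd _ 3).mp ha

/-- **Companion: a rational `3`-isogeny forces `3 ∤ a_ℓ` at every good prime `ℓ ≡ 1 (mod 3)`, `ℓ ≠ 3`**
(`a_ℓ ≡ r(1 + ℓ) = 2r = ±2 ≢ 0 (mod 3)`).
[cite: Mazur1978, §6 Prop. 6.3 (1) (p. 153)]
[cite: Silverman2009, V.2.3.1 and III.8.6] -/
theorem not_three_dvd_frobeniusTrace_of_not_hasIrreducibleModPGaloisRep_three (W : WeierstrassCurve ℚ)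
    [W.IsElliptic] [W.IsGloballyMinimal] (hred : ¬ W.HasIrreducibleModPGaloisRep 3) {ℓ : ℕ}
    [Fact ℓ.Prime] (hgood : W.HasGoodReductionAtPrime ℓ) (hℓ3 : ℓ % 3 = 1) :
    ¬ (3 : ℤ) ∣ W.frobeniusTrace ℓ := by
  haveI : Fact (Nat.Prime 3) := ⟨Nat.prime_three⟩
  have hℓ3' : ℓ ≠ 3 := by rintro rfl; simp at hℓ3
  obtain ⟨u, hu⟩ :=
    exists_unit_root_frobeniusCharpoly_of_not_hasIrreducibleModPGaloisRep W 3 ℓ hℓ3' hgood hred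
  have hsq : (u : ZMod 3) ^ 2 = 1 := units_zmod_three_sq_eq_one u
  have hℓc : (ℓ : ZMod 3) = 1 := by
    have h := (ZMod.natCast_mod ℓ 3).symm
    rw [hℓ3] at h
    simpa using h
  rw [hsq, hℓc] at hu
  intro hdvd
  have ha : (W.frobeniusTrace ℓ : ZMod 3) = 0 := (ZMod.intCast_zmod_eq_zero_iff_dvd _ 3).mpr hdvd
  rw [ha] at hu
  -- `hu : 1 - 0 * u + 1 = 0` in `𝔽₃`: impossible
  have h2 : (1 : ZMod 3) + 1 = 0 := by linear_combination hu
  exact zmod_three_one_add_one_ne_zero h2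

/-- **Conductor-indexed form** (VERBATIM the body of the cell's (T) `ModThreeReducibleTraceVanishing`,
`Summits/BirchSwinnertonDyer/Rank1Residual/F1Sign2/TwistLatticeAtTwo.lean`): `E/ℚ` globally minimal with
reducible `E[3]`, `ℓ` a prime with `ℓ ∤ N_E` (hence good, Silverman ATAEC IV.10.2(a); tree
`hasGoodReductionAtPrime_of_not_dvd_conductorNorm'`) and `ℓ ≡ 2 (mod 3)` ⟹ `3 ∣ a_ℓ`.
[cite: Mazur1978, §6 Prop. 6.3 (1) (p. 153)]
[cite: Silverman1994, IV.10.2(a)] -/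
theorem three_dvd_frobeniusTrace_of_not_hasIrreducibleModPGaloisRep_three_of_not_dvd_conductorNorm :
    ∀ (W : WeierstrassCurve ℚ) [W.IsElliptic] [W.IsGloballyMinimal], ¬ W.HasIrreducibleModPGaloisRep 3 →
      ∀ p : ℕ, p.Prime → ¬ p ∣ W.conductorNorm ℤ → p % 3 = 2 → (3 : ℤ) ∣ W.frobeniusTrace p := by
  intro W _ _ hred p hp hN hp3
  haveI : Fact p.Prime := ⟨hp⟩
  exact three_dvd_frobeniusTrace_of_not_hasIrreducibleModPGaloisRep_three W hred
    (W.hasGoodReductionAtPrime_of_not_dvd_conductorNorm' hN) hp3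

end Literature.NumberTheory.EllipticCurves

end
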